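import Literature.Probability.RandomMatrix.SphereCoordinateDensity
import HarnessLib

/-!
# The law of a linear image of a uniformly random point on a complex sphere

Let `h` be a standard complex Gaussian vector indexed by a finite type `κ` with `|κ| = n + e`,
`n, e ≥ 1` (law `gaussianPi κ`), so that `θ = h/|h|` is uniformly distributed on the unit sphere of
`ℂ^κ`, and let `L` be a complex `n × |κ|` matrix with `M = L L*` invertible. The main result
`map_normalize_mulVec_gaussianPi` computes the law of `L θ ∈ ℂⁿ`:

  `Law(L θ) = C · det(M)⁻¹ (1 − x* M⁻¹ x)^{e−1} 𝟙[x* M⁻¹ x < 1] dx`   (`C = sphereHeadConst n e`),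

with respect to Lebesgue measure on `ℂⁿ` (`projProfile e M`). For `L` the coordinate projection
this is the law of the first `n` coordinates of `θ` (`SphereCoordinateDensity`); the general case is
what the column-by-column computation of the density of a truncated Haar unitary consumes (there
`L = T P` for the truncation `T` and the projection `P` onto the orthogonal complement of the
previous columns, and `M = 1 − Y Y*` for the block `Y` already built).

## Proof

* `exists_orthonormalBasis_adapted`: an orthonormal basis `w` of `ℂ^κ` indexed by `Fin n ⊕ Fin e`
  whose last `e` vectors span `ker L` (orthonormal bases of `(ker L)ᗮ` and `ker L`, glued with
  `OrthonormalBasis.mk`);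
* the coefficients `(⟪w_a, h⟫)_a` are again standard Gaussian (`gaussianEuc_map_orthonormal_repr`,
  file `ComplexGaussianVector`), `|h|` is their Euclidean norm, and `L h = A c₁` for the first block
  `c₁` of coefficients and the invertible `n × n` matrix `A` of columns `L w_{inl i}`, with
  `A A* = L L*` (resolution of the identity `OrthonormalBasis.sum_apply_mul_conj_apply`);
* hence `L θ = A · sphereHead(c₁, c₂)`, and the law of `sphereHead` (`map_sphereHead_gaussianPi_prod`)
  is transported by the linear change of variables `v ↦ A v` on `ℂⁿ ≅ ℝ^{2n}`, whose Jacobian is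
  `|det A|² = det M` (`map_mulVec_withDensity`, `volume_map_mulVec`, via
  `LinearMap.det_restrictScalars`), while `|A⁻¹ x|² = x* M⁻¹ x`.

## References

Standard (e.g. R. J. Muirhead, *Aspects of multivariate statistical theory*, Wiley 1982, §1.5, for
the real analogue); used implicitly in D. Petz, J. Réffy, *On asymptotics of large Haar distributed
unitary matrices*, Period. Math. Hungar. 49 (2004) 103–117, §2, and in S. Aaronson, A. Arkhipov,
*The computational complexity of linear optics*, Theory of Computing 9 (2013), §5.1.
-/

open MeasureTheory ProbabilityTheory Complex WithLp Real Set Matrix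
open scoped ENNReal NNReal ComplexOrder

namespace Literature.Probability.RandomMatrix

open Literature.Computability.QuantumComplexity (map_withDensity_equiv stdComplexGaussian)

/-! ### Linear change of variables on `ℂⁿ` -/

section LinearCOV

variable {n : ℕ}

/-- The real determinant of `v ↦ A v` on `ℂⁿ` (viewed as `ℝ^{2n}`) is `|det A|²`. [folklore] -/
theorem det_restrictScalars_toLin' (A : Matrix (Fin n) (Fin n) ℂ) :
    LinearMap.det ((Matrix.toLin' A).restrictScalars ℝ) = Complex.normSq A.det := by
  rw [LinearMap.det_restrictScalars, Algebra.norm_complex_apply, LinearMap.det_toLin']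

/-- **Lebesgue measure under an invertible linear map of `ℂⁿ`**:
`vol ∘ (A ·)⁻¹ = |det A|⁻² · vol`. [folklore] -/
theorem volume_map_mulVec (A : Matrix (Fin n) (Fin n) ℂ) (hA : A.det ≠ 0) :
    (volume : Measure (Fin n → ℂ)).map (fun v => A *ᵥ v) =
      ENNReal.ofReal ((Complex.normSq A.det)⁻¹) • volume := by
  have hdet : LinearMap.det ((Matrix.toLin' A).restrictScalars ℝ) ≠ 0 := by
    rw [det_restrictScalars_toLin']
    exact (Complex.normSq_pos.2 hA).ne'
  have h := Measure.map_linearMap_addHaar_eq_smul_addHaar (volume : Measure (Fin n → ℂ)) hdet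
  rw [det_restrictScalars_toLin'] at h
  have hcoe : (⇑((Matrix.toLin' A).restrictScalars ℝ) : (Fin n → ℂ) → Fin n → ℂ) = fun v => A *ᵥ v := by
    funext v; simp [Matrix.toLin'_apply]
  rw [hcoe] at h
  rw [h, abs_of_nonneg (inv_nonneg.2 (Complex.normSq_nonneg _))]

/-- `v ↦ A v` as a measurable equivalence of `ℂⁿ`, for invertible `A`. [folklore] -/
noncomputable def mulVecMeasurableEquiv (A : Matrix (Fin n) (Fin n) ℂ) [Invertible A] :
    (Fin n → ℂ) ≃ᵐ (Fin n → ℂ) :=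
  ((Matrix.toLinearEquiv' A ‹_›).toContinuousLinearEquiv).toHomeomorph.toMeasurableEquiv

/-- The forward map is `v ↦ A v`. [folklore] -/
theorem mulVecMeasurableEquiv_apply (A : Matrix (Fin n) (Fin n) ℂ) [Invertible A] (v : Fin n → ℂ) :
    mulVecMeasurableEquiv A v = A *ᵥ v := by
  change Matrix.toLin' A v = A *ᵥ v
  exact Matrix.toLin'_apply A v

/-- The inverse map is `x ↦ A⁻¹ x`. [folklore] -/
theorem mulVecMeasurableEquiv_symm_apply (A : Matrix (Fin n) (Fin n) ℂ) [Invertible A]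
    (x : Fin n → ℂ) : (mulVecMeasurableEquiv A).symm x = A⁻¹ *ᵥ x := by
  change Matrix.toLin' (⅟A) x = A⁻¹ *ᵥ x
  rw [Matrix.toLin'_apply, Matrix.invOf_eq_nonsing_inv]

/-- `v ↦ A v` is measurable. [folklore] -/
theorem measurable_mulVec {m k : Type*} [Fintype m] [Fintype k] (A : Matrix m k ℂ) :
    Measurable fun v : k → ℂ => A *ᵥ v :=
  (continuous_const.matrix_mulVec continuous_id).measurable

/-- **Linear change of variables for densities on `ℂⁿ`**: for invertible `A` and a measurable
`D ≥ 0`, the image of `D · vol` under `v ↦ A v` is `|det A|⁻² D(A⁻¹ ·) · vol`. [folklore] -/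
theorem map_mulVec_withDensity (A : Matrix (Fin n) (Fin n) ℂ) (hA : A.det ≠ 0)
    (D : (Fin n → ℂ) → ℝ≥0∞) (hD : Measurable D) :
    (volume.withDensity D).map (fun v => A *ᵥ v) =
      volume.withDensity (fun x => ENNReal.ofReal ((Complex.normSq A.det)⁻¹) * D (A⁻¹ *ᵥ x)) := by
  haveI : Invertible A := Matrix.invertibleOfIsUnitDet A (Ne.isUnit hA)
  have hcoe : (fun v : Fin n → ℂ => A *ᵥ v) = mulVecMeasurableEquiv A :=
    funext fun v => (mulVecMeasurableEquiv_apply A v).symm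
  have hmeas : Measurable (D ∘ (mulVecMeasurableEquiv A).symm) :=
    hD.comp (MeasurableEquiv.measurable _)
  rw [hcoe, map_withDensity_equiv, ← hcoe, volume_map_mulVec A hA, withDensity_smul_measure,
    ← withDensity_smul _ hmeas]
  congr 1
  funext x
  simp only [Pi.smul_apply, smul_eq_mul, Function.comp_apply, mulVecMeasurableEquiv_symm_apply]

end LinearCOV

/-! ### An orthonormal basis adapted to the kernel of a surjection -/

section Adapted

variable {κ : Type*} [Fintype κ] {n e : ℕ}

/-- **Adapted orthonormal basis.** For a surjective linear map `Λ : ℂ^κ → ℂⁿ` with `|κ| = n + e`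
there is an orthonormal basis `w` of `ℂ^κ` indexed by `Fin n ⊕ Fin e` whose last `e` vectors lie in
`ker Λ` (orthonormal bases of `(ker Λ)ᗮ` and `ker Λ`, of dimensions `n` and `e`). [folklore] -/
theorem exists_orthonormalBasis_adapted (Λ : EuclideanSpace ℂ κ →ₗ[ℂ] (Fin n → ℂ))
    (hsurj : Function.Surjective Λ) (hcard : Fintype.card κ = n + e) :
    ∃ w : OrthonormalBasis (Fin n ⊕ Fin e) ℂ (EuclideanSpace ℂ κ), ∀ j, Λ (w (Sum.inr j)) = 0 := by
  have hdim : Module.finrank ℂ (EuclideanSpace ℂ κ) = n + e := by rw [finrank_euclideanSpace, hcard]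
  have hrange : Module.finrank ℂ (LinearMap.range Λ) = n := by
    rw [LinearMap.range_eq_top.2 hsurj, finrank_top, Module.finrank_fin_fun]
  have hK_rank : Module.finrank ℂ (LinearMap.ker Λ) = e := by
    have := LinearMap.finrank_range_add_finrank_ker Λ
    rw [hrange, hdim] at this
    omega
  have hKo_rank : Module.finrank ℂ (LinearMap.ker Λ)ᗮ = n := by
    have := Submodule.finrank_add_finrank_orthogonal (LinearMap.ker Λ)
    rw [hK_rank, hdim] at this
    omega
  let K : Submodule ℂ (EuclideanSpace ℂ κ) := LinearMap.ker Λ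
  let b₁ : OrthonormalBasis (Fin n) ℂ Kᗮ := (stdOrthonormalBasis ℂ Kᗮ).reindex (finCongr hKo_rank)
  let b₂ : OrthonormalBasis (Fin e) ℂ K := (stdOrthonormalBasis ℂ K).reindex (finCongr hK_rank)
  let v : Fin n ⊕ Fin e → EuclideanSpace ℂ κ :=
    Sum.elim (fun i => (b₁ i : EuclideanSpace ℂ κ)) (fun j => (b₂ j : EuclideanSpace ℂ κ))
  have hv : Orthonormal ℂ v := by
    rw [orthonormal_iff_ite]
    rintro (i | j) (i' | j')
    · change inner ℂ (b₁ i : EuclideanSpace ℂ κ) (b₁ i' : EuclideanSpace ℂ κ) = _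
      rw [← Submodule.coe_inner, orthonormal_iff_ite.1 b₁.orthonormal i i']
      by_cases h : i = i' <;> simp [h]
    · change inner ℂ (b₁ i : EuclideanSpace ℂ κ) (b₂ j' : EuclideanSpace ℂ κ) = _
      rw [Submodule.inner_left_of_mem_orthogonal (b₂ j').2 (b₁ i).2]
      simp
    · change inner ℂ (b₂ j : EuclideanSpace ℂ κ) (b₁ i' : EuclideanSpace ℂ κ) = _
      rw [Submodule.inner_right_of_mem_orthogonal (b₂ j).2 (b₁ i').2]
      simp
    · change inner ℂ (b₂ j : EuclideanSpace ℂ κ) (b₂ j' : EuclideanSpace ℂ κ) = _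
      rw [← Submodule.coe_inner, orthonormal_iff_ite.1 b₂.orthonormal j j']
      by_cases h : j = j' <;> simp [h]
  have hspan : ⊤ ≤ Submodule.span ℂ (Set.range v) := by
    rw [Set.Sum.elim_range, Submodule.span_union]
    have h1 : Submodule.span ℂ (Set.range fun i => (b₁ i : EuclideanSpace ℂ κ)) = Kᗮ := by
      have : (Set.range fun i => (b₁ i : EuclideanSpace ℂ κ)) = Kᗮ.subtype '' Set.range b₁ := by
        ext x; simp [Set.mem_image, Set.mem_range]
      rw [this, Submodule.span_image, ← OrthonormalBasis.coe_toBasis, b₁.toBasis.span_eq,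
        Submodule.map_subtype_top]
    have h2 : Submodule.span ℂ (Set.range fun j => (b₂ j : EuclideanSpace ℂ κ)) = K := by
      have : (Set.range fun j => (b₂ j : EuclideanSpace ℂ κ)) = K.subtype '' Set.range b₂ := by
        ext x; simp [Set.mem_image, Set.mem_range]
      rw [this, Submodule.span_image, ← OrthonormalBasis.coe_toBasis, b₂.toBasis.span_eq,
        Submodule.map_subtype_top]
    rw [h1, h2, sup_comm, Submodule.sup_orthogonal_of_hasOrthogonalProjection]
  refine ⟨OrthonormalBasis.mk hv hspan, fun j => ?_⟩
  rw [OrthonormalBasis.coe_mk]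
  change Λ (b₂ j : EuclideanSpace ℂ κ) = 0
  exact (b₂ j).2

end Adapted

/-! ### Resolution of the identity for an orthonormal basis of `ℂ^κ` -/

/-- For an orthonormal basis `w` of `EuclideanSpace ℂ κ`: `∑_a w_a(k) \overline{w_a(l)} = δ_{kl}`.
[folklore] -/
theorem OrthonormalBasis.sum_apply_mul_conj_apply {κ α : Type*} [Fintype κ] [DecidableEq κ]
    [Fintype α] (w : _root_.OrthonormalBasis α ℂ (EuclideanSpace ℂ κ)) (k l : κ) :
    ∑ a, w a k * starRingEnd ℂ (w a l) = if k = l then 1 else 0 := by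
  have h := w.sum_inner_mul_inner (EuclideanSpace.single k (1 : ℂ)) (EuclideanSpace.single l (1 : ℂ))
  simp only [EuclideanSpace.inner_single_left, EuclideanSpace.inner_single_right, map_one, one_mul] at h
  rw [h]
  change starRingEnd ℂ ((PiLp.single 2 k (1 : ℂ) : PiLp 2 (fun _ : κ => ℂ)).ofLp l) = _
  rw [PiLp.single_apply]
  by_cases hkl : k = l
  · subst hkl; simp
  · simp [hkl, Ne.symm hkl]

/-! ### Quadratic forms and the density profile -/

section Profile

variable {n : ℕ}

/-- `Re(v* v) = ∑|vᵢ|²`. [folklore] -/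
theorem re_star_dotProduct_self (v : Fin n → ℂ) : (star v ⬝ᵥ v).re = nsq v := by
  simp only [dotProduct, Pi.star_apply, Complex.re_sum, nsq]
  refine Finset.sum_congr rfl fun i _ => ?_
  rw [Complex.star_def, ← Complex.normSq_eq_conj_mul_self, Complex.ofReal_re, Complex.normSq_eq_norm_sq]

/-- The quadratic form `ρ_M(x) = Re(x* M⁻¹ x)` of the inverse of `M`. [folklore] -/
noncomputable def invQuadForm (M : Matrix (Fin n) (Fin n) ℂ) (x : Fin n → ℂ) : ℝ :=
  (star x ⬝ᵥ M⁻¹ *ᵥ x).re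

/-- The density profile `det(M)⁻¹ (1 − x* M⁻¹ x)^{e−1} 𝟙[x* M⁻¹ x < 1]` of the law of a linear image
`L θ` (`L L* = M`) of a uniform point `θ` on the unit sphere of `ℂ^{n+e}`. [folklore] -/
noncomputable def projProfile (e : ℕ) (M : Matrix (Fin n) (Fin n) ℂ) (x : Fin n → ℂ) : ℝ :=
  (M.det.re)⁻¹ * (if invQuadForm M x < 1 then (1 - invQuadForm M x) ^ (e - 1) else 0)

/-- For `M = A A*` with `A` invertible: `x* M⁻¹ x = |A⁻¹ x|²`. [folklore] -/
theorem invQuadForm_mul_conjTranspose (A : Matrix (Fin n) (Fin n) ℂ) (x : Fin n → ℂ) :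
    invQuadForm (A * Aᴴ) x = nsq (A⁻¹ *ᵥ x) := by
  rw [invQuadForm, Matrix.mul_inv_rev, ← Matrix.conjTranspose_nonsing_inv, ← Matrix.mulVec_mulVec,
    Matrix.dotProduct_mulVec, ← Matrix.star_mulVec, re_star_dotProduct_self]

/-- For `M = A A*`: `Re det M = |det A|²`. [folklore] -/
theorem re_det_mul_conjTranspose (A : Matrix (Fin n) (Fin n) ℂ) :
    ((A * Aᴴ).det).re = Complex.normSq A.det := by
  rw [Matrix.det_mul, Matrix.det_conjTranspose, Complex.star_def, Complex.mul_conj, Complex.ofReal_re]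

/-- For `M = A A*` with `A` invertible the profile is `|det A|⁻² (1 − |A⁻¹x|²)_+^{e−1}`, i.e. the
`headProfile` of `SphereCoordinateDensity` transported by `A`. [folklore] -/
theorem projProfile_mul_conjTranspose (e : ℕ) (A : Matrix (Fin n) (Fin n) ℂ) (x : Fin n → ℂ) :
    projProfile e (A * Aᴴ) x = (Complex.normSq A.det)⁻¹ * headProfile n e (A⁻¹ *ᵥ x) := by
  rw [projProfile, re_det_mul_conjTranspose, invQuadForm_mul_conjTranspose, headProfile]

/-- The profile is measurable. [folklore] -/
theorem measurable_projProfile (e : ℕ) (M : Matrix (Fin n) (Fin n) ℂ) :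
    Measurable (projProfile e M) := by
  have hq : Measurable (invQuadForm M) := by
    unfold invQuadForm
    refine Complex.measurable_re.comp ?_
    exact Continuous.measurable (by fun_prop)
  unfold projProfile
  exact measurable_const.mul (Measurable.ite (measurableSet_lt hq measurable_const)
    ((measurable_const.sub hq).pow_const _) measurable_const)

end Profile

/-! ### The law of `L(h/|h|)` for a standard complex Gaussian vector `h` -/

section Projected

variable {κ : Type*} [Fintype κ] [DecidableEq κ] {n e : ℕ}

omit [DecidableEq κ] in
/-- `x ↦ L x` is onto when `L L*` is invertible. [folklore] -/
theorem mulVec_surjective_of_det_ne_zero (L : Matrix (Fin n) κ ℂ) (hM : (L * Lᴴ).det ≠ 0) :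
    Function.Surjective fun h : κ → ℂ => L *ᵥ h := by
  intro y
  refine ⟨Lᴴ *ᵥ ((L * Lᴴ)⁻¹ *ᵥ y), ?_⟩
  dsimp only
  rw [Matrix.mulVec_mulVec, Matrix.mulVec_mulVec,
    Matrix.mul_nonsing_inv _ (isUnit_iff_ne_zero.2 hM), Matrix.one_mulVec]

/-- A matrix acts on a vector as the combination of its columns. [folklore] -/
theorem mulVec_eq_sum_smul_cols {m : Type*} (B : Matrix m (Fin n) ℂ) (v : Fin n → ℂ) :
    B *ᵥ v = ∑ i, v i • fun i' => B i' i := by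
  funext i'
  simp only [Matrix.mulVec, dotProduct, Finset.sum_apply, Pi.smul_apply, smul_eq_mul]
  exact Finset.sum_congr rfl fun i _ => mul_comm _ _

/-- **The law of a linear image of a uniform point on a complex sphere.** Let `h` be a standard
complex Gaussian vector indexed by `κ`, `|κ| = n + e` with `n, e ≥ 1` (so `h/|h|` is uniform on the
unit sphere of `ℂ^κ`), and `L` an `n × |κ|` complex matrix with `M = L L*` invertible. Then
`L (h/|h|) ∈ ℂⁿ` has the law `C det(M)⁻¹ (1 − x* M⁻¹ x)_+^{e−1} dx` with `C = sphereHeadConst n e`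
(the constant of `map_sphereHead_gaussianPi_prod`). Proof: in an orthonormal basis of `ℂ^κ` adapted
to `ker L` (`exists_orthonormalBasis_adapted`) the coefficients of `h` are again standard Gaussian
(`gaussianEuc_map_orthonormal_repr`), `L (h/|h|) = A · sphereHead(coefficients)` for an invertible
`A` with `A A* = M`, and the law of `sphereHead` is transported by the linear change of variables
`map_mulVec_withDensity`. [folklore] -/
theorem map_normalize_mulVec_gaussianPi (hn : 1 ≤ n) (he : 1 ≤ e)
    (hcard : Fintype.card κ = n + e) (L : Matrix (Fin n) κ ℂ) (hM : (L * Lᴴ).det ≠ 0) :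
    (gaussianPi κ).map (fun h => (Real.sqrt (nsq h))⁻¹ • L *ᵥ h) =
      volume.withDensity
        (fun x => sphereHeadConst n e * ENNReal.ofReal (projProfile e (L * Lᴴ) x)) := by
  classical
  -- the linear map on the Euclidean space and an adapted orthonormal basis
  let Λ : EuclideanSpace ℂ κ →ₗ[ℂ] (Fin n → ℂ) :=
    L.mulVecLin.comp (WithLp.linearEquiv 2 ℂ (κ → ℂ)).toLinearMap
  have hΛ : ∀ x, Λ x = L *ᵥ ofLp x := fun x => rfl
  have hsurj : Function.Surjective Λ := by
    intro y
    obtain ⟨h, hh⟩ := mulVec_surjective_of_det_ne_zero L hM y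
    exact ⟨toLp 2 h, by rw [hΛ]; exact hh⟩
  obtain ⟨w, hw⟩ := exists_orthonormalBasis_adapted Λ hsurj hcard
  -- the vectors `t a = L w_a` and the matrix `A` of the first `n` of them
  set t : Fin n ⊕ Fin e → (Fin n → ℂ) := fun a => L *ᵥ ofLp (w a) with ht_def
  have ht : ∀ j, t (Sum.inr j) = 0 := fun j => by rw [ht_def]; exact (hΛ _).symm.trans (hw j)
  set A : Matrix (Fin n) (Fin n) ℂ := Matrix.of fun i' i => t (Sum.inl i) i' with hA_def
  have hAv : ∀ v : Fin n → ℂ, A *ᵥ v = ∑ i, v i • t (Sum.inl i) := fun v => by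
    rw [mulVec_eq_sum_smul_cols]; rfl
  -- `A A* = L L*`
  have hAA : A * Aᴴ = L * Lᴴ := by
    ext a b
    have h1 : (A * Aᴴ) a b = ∑ i, t (Sum.inl i) a * starRingEnd ℂ (t (Sum.inl i) b) := by
      simp only [Matrix.mul_apply, Matrix.conjTranspose_apply, hA_def, Matrix.of_apply,
        Complex.star_def]
    have h2 : ∑ i, t (Sum.inl i) a * starRingEnd ℂ (t (Sum.inl i) b) =
        ∑ c, t c a * starRingEnd ℂ (t c b) := by
      rw [Fintype.sum_sum_type]
      simp [ht]
    have h3 : ∀ c, t c a * starRingEnd ℂ (t c b) =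
        ∑ k, ∑ l, L a l * starRingEnd ℂ (L b k) * (w c l * starRingEnd ℂ (w c k)) := by
      intro c
      rw [ht_def]
      simp only [Matrix.mulVec, dotProduct, map_sum, map_mul, Finset.sum_mul, Finset.mul_sum]
      refine Finset.sum_congr rfl fun k _ => Finset.sum_congr rfl fun l _ => ?_
      ring
    rw [h1, h2]
    simp_rw [h3]
    rw [Finset.sum_comm]
    simp_rw [Finset.sum_comm (s := (Finset.univ : Finset (Fin n ⊕ Fin e))), ← Finset.mul_sum,
      OrthonormalBasis.sum_apply_mul_conj_apply w]
    simp only [mul_ite, mul_one, mul_zero, Finset.sum_ite_eq', Finset.mem_univ, if_true]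
    simp only [Matrix.mul_apply, Matrix.conjTranspose_apply, Complex.star_def]
  have hAdet : A.det ≠ 0 := by
    intro h0
    apply hM
    rw [← hAA, Matrix.det_mul, h0, zero_mul]
  -- coefficients in the basis `w` are standard Gaussian
  set c : EuclideanSpace ℂ κ → (Fin n ⊕ Fin e → ℂ) := fun x a => inner ℂ (w a) x with hc_def
  have hcm : Measurable c :=
    measurable_pi_lambda _ fun a => (continuous_const.inner continuous_id).measurable
  have hc : (gaussianEuc κ).map c = gaussianPi (Fin n ⊕ Fin e) :=
    gaussianEuc_map_orthonormal_repr w.orthonormal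
  -- the two maps
  set G : (κ → ℂ) → (Fin n → ℂ) := fun h => (Real.sqrt (nsq h))⁻¹ • L *ᵥ h with hG_def
  set Ψ : (Fin n ⊕ Fin e → ℂ) → (Fin n → ℂ) :=
    fun h' => (Real.sqrt (nsq h'))⁻¹ • A *ᵥ (fun i => h' (Sum.inl i)) with hΨ_def
  have hGm : Measurable G := (measurable_nsq.sqrt.inv).smul (measurable_mulVec L)
  have hΨm : Measurable Ψ :=
    (measurable_nsq.sqrt.inv).smul ((measurable_mulVec A).comp
      (measurable_pi_lambda _ fun i => measurable_pi_apply (Sum.inl i)))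
  -- pointwise: `G (ofLp x) = Ψ (c x)`
  have hpt : ∀ x : EuclideanSpace ℂ κ, G (ofLp x) = Ψ (c x) := by
    intro x
    have hn : nsq (ofLp x) = nsq (c x) := by
      rw [nsq_ofLp, ← w.sum_sq_norm_inner_right x]; rfl
    have hL : L *ᵥ ofLp x = A *ᵥ (fun i => c x (Sum.inl i)) := by
      conv_lhs => rw [← w.sum_repr' x]
      rw [WithLp.ofLp_sum, Matrix.mulVec_sum]
      simp only [WithLp.ofLp_smul, Matrix.mulVec_smul]
      rw [Fintype.sum_sum_type]
      have : ∑ j, inner ℂ (w (Sum.inr j)) x • L *ᵥ ofLp (w (Sum.inr j)) = 0 :=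
        Finset.sum_eq_zero fun j _ => by
          have := ht j; rw [ht_def] at this; dsimp only at this; rw [this, smul_zero]
      rw [this, add_zero, hAv]
    rw [hG_def, hΨ_def]
    dsimp only
    rw [hn, hL]
  -- the law of `G` is the law of `Ψ` under `γ^{n ⊕ e}`
  have h1 : (gaussianPi κ).map G = (gaussianPi (Fin n ⊕ Fin e)).map Ψ := by
    rw [gaussianPi_eq_map_ofLp κ, Measure.map_map hGm (measurable_ofLp_two κ),
      show G ∘ ofLp = Ψ ∘ c from funext hpt, ← Measure.map_map hΨm hcm, hc]
  -- split `n ⊕ e` and recognise `sphereHead`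
  have h2 : (gaussianPi (Fin n ⊕ Fin e)).map Ψ =
      (((gaussianPi (Fin n)).prod (gaussianPi (Fin e))).map (sphereHead n e)).map
        (fun v => A *ᵥ v) := by
    have hmp := measurePreserving_sumPiEquivProdPi (fun _ : Fin n ⊕ Fin e => stdComplexGaussian)
    set E := MeasurableEquiv.sumPiEquivProdPi (fun _ : Fin n ⊕ Fin e => ℂ) with hE
    have hpi : gaussianPi (Fin n ⊕ Fin e) =
        ((gaussianPi (Fin n)).prod (gaussianPi (Fin e))).map E.symm := by
      rw [gaussianPi, gaussianPi, gaussianPi, ← hmp.symm.map_eq]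
    have hcomp : Ψ ∘ E.symm = (fun v => A *ᵥ v) ∘ sphereHead n e := by
      funext p
      simp only [Function.comp_apply, hΨ_def, sphereHead, Matrix.mulVec_smul]
      congr 2
      · rw [hE, MeasurableEquiv.coe_sumPiEquivProdPi_symm, nsq, Fintype.sum_sum_type]
        rfl
    rw [hpi, Measure.map_map hΨm E.symm.measurable, hcomp,
      ← Measure.map_map (measurable_mulVec A) (measurable_sphereHead n e)]
  have hD : Measurable fun w : Fin n → ℂ =>
      sphereHeadConst n e * ENNReal.ofReal (headProfile n e w) :=
    measurable_const.mul (ENNReal.measurable_ofReal.comp (measurable_headProfile n e))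
  rw [h1, h2, map_sphereHead_gaussianPi_prod n e hn he, map_mulVec_withDensity A hAdet _ hD]
  congr 1
  funext x
  rw [← hAA, projProfile_mul_conjTranspose, ENNReal.ofReal_mul (inv_nonneg.2 (Complex.normSq_nonneg _))]
  ring

end Projected

end Literature.Probability.RandomMatrix
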